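import Summits.CriticalPhenomena.PercolationContinuityZ3.Theorems.PercNearOneGluingNoHeavyLowerTailFloorSplitOneLayerSums
import Summits.CriticalPhenomena.PercolationContinuityZ3.Theorems.PercNearOneGluingNoHeavyLowerTailFloorSplitStarAlgebra
import HarnessLib

/-!
# `NoHeavyLowerTail` (stmt-CriticalPhenomena-4575) — one-layer observers: the star row on `G ∖ {o}`, the floor
# weights, and `σ' ≥ 0`

Helper file of lemma factory #5 (`prim-lf-5`, gen 10; memo `run/shared/lean/prim/prim-lf-5/FSCIL-ONELAYER-PROOF.md`,
Step 2 and (L1), (L3)).  `--supports stmt-CriticalPhenomena-4575`.  No definitions, no named facts, no sorries.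

* `starRow_transfer`: the star row of `FloorSplitStarRows` read on `H = G ∖ {o}` through the restriction coupling:
  `μ(E^U_B ∩ E^nc_{v,B}) + μ(E^small_v ∩ E^conn_{v,B}) ≤ μ(E^small_c)` when `c` is `H`-lighter than `v` and than
  some `b ∈ B` (notation of `…FloorSplitOneLayerSums`).
* the floor weights `φ_a = μ(o ↔ a, N_a = 1)/μ(N_a = 1)` of a one-layer observer satisfy
  `φ_a ≤ μ(σ_{{a}})/(μ(σ_{{a}}) + Σ_{B ∌ a} μ(σ_B))` (`phi_le`; with equality unless `μ_H(B_a = {a}) = 0`):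
  `{o ↔ a, N_a = 1} ∩ σ_B` is empty unless `B = {a}` (`real_conn_lonely_le`), and `{N_a = 1} ⊇ σ_B ∩ {a H-lonely}`
  for `B = {a}` and for every `B ∌ a` (`real_lonely_ge`).
* `sigma_nonneg`: the abstract form of Kozma–Nitzan's Lemma 2 for one-layer observers — star weights `w ≥ 0` summing
  to one and `0 ≤ φ_a ≤ w{a}/(w{a} + Σ_{B∌a} w)` give `Σ_a φ_a ≤ Σ_{B ≠ ∅} w(B)` (elementary: `φ_a(1 − ρ_a) ≤ w{a}`).
-/

noncomputable section

namespace Summit.CriticalPhenomena.PercolationContinuityZ3.Theorems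

open MeasureTheory Set Literature.Probability.LatticeModels Literature.Probability.Percolation
open Literature.Probability.Percolation.KNPreFKG
open scoped Classical

namespace FloorSplitOneLayer

/-! ### `σ' ≥ 0` (abstract) -/

section Abstract

open Finset

variable {ι : Type*} [DecidableEq ι]

/-- **`σ' ≥ 0`, abstract form** (Kozma–Nitzan's Lemma 2 for a one-layer observer): if `w ≥ 0` sums to `1` over the
subsets of `A` and `0 ≤ φ_a ≤ w{a}/(w{a} + Σ_{B∌a} w(B))`, then `Σ_a φ_a ≤ Σ_{B ≠ ∅} w(B)`.  Proof:
`φ_a(1 − ρ_a) ≤ w{a}` with `ρ_a ≤ W₂` the weight of the multi-stars containing `a`, so `Φ(1 − W₂) ≤ S` and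
`S/(1 − W₂) ≤ S + W₂` because `π W₂ ≥ 0`. [this work; cite: KozmaNitzan2024, Lemma 2 (p. 6)] -/
theorem sigma_nonneg (A : Finset ι) (w : Finset ι → ℝ) (φ : ι → ℝ)
    (hw0 : ∀ B ∈ A.powerset, 0 ≤ w B) (hw1 : ∑ B ∈ A.powerset, w B = 1)
    (hφ0 : ∀ a ∈ A, 0 ≤ φ a)
    (hφ1 : ∀ a ∈ A, φ a ≤ w {a} / (w {a} + ∑ B ∈ A.powerset.filter (fun B => a ∉ B), w B)) :
    ∑ a ∈ A, φ a ≤ ∑ B ∈ A.powerset.filter (fun B => B.Nonempty), w B := by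
  set P2 : Finset (Finset ι) := A.powerset.filter (fun B => 2 ≤ B.card) with hP2
  have hP2P : ∀ B ∈ P2, B ∈ A.powerset := fun B hB => (mem_filter.1 hB).1
  have hP2A : ∀ B ∈ P2, B ⊆ A := fun B hB => mem_powerset.1 (hP2P B hB)
  have hP2w : ∀ B ∈ P2, 0 ≤ w B := fun B hB => hw0 B (mem_filter.1 hB).1
  have hP2c : ∀ B ∈ P2, 2 ≤ B.card := fun B hB => (mem_filter.1 hB).2
  set π : ℝ := w ∅ with hπ
  set S : ℝ := ∑ a ∈ A, w {a} with hS
  set W₂ : ℝ := ∑ B ∈ P2, w B with hW₂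
  set Φ : ℝ := ∑ a ∈ A, φ a with hΦ
  have hπ0 : 0 ≤ π := hw0 ∅ (by simp)
  have hS0 : 0 ≤ S := sum_nonneg fun a ha => hw0 {a} (by simpa using ha)
  have hW₂0 : 0 ≤ W₂ := sum_nonneg hP2w
  have htot : π + S + W₂ = 1 := by rw [← hw1, sum_powerset_split A w]
  have hPoA : ∑ B ∈ A.powerset.filter (fun B => B.Nonempty), w B = S + W₂ := by
    have e := sum_powerset_split A (fun B => if B.Nonempty then w B else 0)
    rw [← sum_filter] at e
    have e1 : ∑ a ∈ A, (if ({a} : Finset ι).Nonempty then w {a} else 0) = S := by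
      rw [hS]
      exact sum_congr rfl fun a _ => by rw [if_pos (Finset.singleton_nonempty a)]
    have e2 : ∑ B ∈ P2, (if B.Nonempty then w B else 0) = W₂ := by
      rw [hW₂]
      refine sum_congr rfl fun B hB => ?_
      rw [if_pos (Finset.card_pos.1 (by linarith [hP2c B hB]))]
    rw [e, if_neg (by simp), zero_add, e1, e2]
  have hcompl : ∀ a ∈ A, w {a} + ∑ B ∈ A.powerset.filter (fun B => a ∉ B), w B =
      1 - ∑ B ∈ P2.filter (fun B => a ∈ B), w B := by
    intro a ha
    have e1 := sum_filter_add_sum_filter_not A.powerset (fun B => a ∈ B) w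
    have e2 := sum_filter_add_sum_filter_not (A.powerset.filter fun B => a ∈ B) (fun B => B.card ≤ 1) w
    have e3 : ((A.powerset.filter fun B => a ∈ B).filter fun B => B.card ≤ 1) = {{a}} := by
      rw [filter_filter]; exact filter_powerset_mem_card_le_one A ha
    have e4 : ((A.powerset.filter fun B => a ∈ B).filter fun B => ¬ B.card ≤ 1) =
        P2.filter fun B => a ∈ B := by
      ext B; simp only [mem_filter, hP2, not_le]; constructor
      · rintro ⟨⟨h1, h2⟩, h3⟩; exact ⟨⟨h1, h3⟩, h2⟩
      · rintro ⟨⟨h1, h3⟩, h2⟩; exact ⟨⟨h1, h2⟩, h3⟩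
    rw [e3, e4, sum_singleton] at e2
    linarith [hw1, e1, e2]
  have hρle : ∀ a ∈ A, ∑ B ∈ P2.filter (fun B => a ∈ B), w B ≤ W₂ := fun a _ =>
    sum_le_sum_of_subset_of_nonneg (filter_subset _ _) fun B hB _ => hP2w B hB
  have hε : ∀ a ∈ A, φ a * (1 - ∑ B ∈ P2.filter (fun B => a ∈ B), w B) ≤ w {a} := by
    intro a ha
    have hden0 : 0 ≤ w {a} + ∑ B ∈ A.powerset.filter (fun B => a ∉ B), w B :=
      add_nonneg (hw0 {a} (by simpa using ha)) (sum_nonneg fun B hB => hw0 B (mem_filter.1 hB).1)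
    rw [← hcompl a ha]
    rcases hden0.eq_or_lt with h0 | hpos
    · rw [← h0, mul_zero]; exact hw0 {a} (by simpa using ha)
    · exact (le_div_iff₀ hpos).1 (hφ1 a ha)
  have hΦb : Φ * (1 - W₂) ≤ S := by
    rw [hΦ, sum_mul, hS]
    refine sum_le_sum fun a ha => le_trans ?_ (hε a ha)
    exact mul_le_mul_of_nonneg_left (by linarith [hρle a ha]) (hφ0 a ha)
  rw [hPoA]
  by_cases hW1 : W₂ = 1
  · have hS' : S = 0 := by linarith [htot]
    have hwa : ∀ a ∈ A, w {a} = 0 :=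
      (sum_eq_zero_iff_of_nonneg (fun a ha => hw0 {a} (by simpa using ha))).1 (hS ▸ hS')
    have hφle : ∀ a ∈ A, φ a ≤ 0 := by
      intro a ha
      have := hφ1 a ha
      rw [hwa a ha, zero_div] at this
      exact this
    have : Φ ≤ 0 := sum_nonpos hφle
    linarith
  · have hpos : 0 < 1 - W₂ := by
      rcases (show W₂ ≤ 1 by linarith [htot]).eq_or_lt with h | h
      · exact absurd h hW1
      · linarith
    have key : 0 ≤ (S + W₂ - Φ) * (1 - W₂) := by nlinarith [hΦb, hπ0, hW₂0, htot]
    have := (mul_nonneg_iff_of_pos_right hpos).1 key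
    linarith

end Abstract

variable {V : Type*} [Fintype V]

/-! ### The star row on `G ∖ {o}` -/

/-- **The star row, transferred to `H = G ∖ {o}`.**  If `μ(E^small_v) ≤ μ(E^small_c)` and
`μ(E^small_b) ≤ μ(E^small_c)` for some `b ∈ B` (the relay `c` is `H`-lighter than `v` and than a member of the
star), then `μ(E^U_B ∩ E^nc_{v,B}) + μ(E^small_v ∩ E^conn_{v,B}) ≤ μ(E^small_c)` — `FloorSplitOneLayer.starRow_small`
for the restricted weights on `{o}ᶜ` and the monotone property `|C ∩ A| > j`, read back through the restriction
coupling. [this work] -/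
theorem starRow_transfer (w : Sym2 V → unitInterval) (A : Finset V) {o : V} (j : ℕ) {B : Finset V}
    (hB : ∀ u ∈ B, u ≠ o) {c v : V} (hc : c ≠ o) (hv : v ≠ o)
    (hcv : (prodBernoulli w).real {ω : BondConfig V | (A.filter fun x => ω ∈ openConnIn {o}ᶜ v x).card ≤ j} ≤
      (prodBernoulli w).real {ω : BondConfig V | (A.filter fun x => ω ∈ openConnIn {o}ᶜ c x).card ≤ j})
    (hcB : ∃ b ∈ B,
      (prodBernoulli w).real {ω : BondConfig V | (A.filter fun x => ω ∈ openConnIn {o}ᶜ b x).card ≤ j} ≤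
        (prodBernoulli w).real {ω : BondConfig V | (A.filter fun x => ω ∈ openConnIn {o}ᶜ c x).card ≤ j}) :
    (prodBernoulli w).real ({ω : BondConfig V |
          (A.filter fun x => ∃ u ∈ B, ω ∈ openConnIn {o}ᶜ u x).card ≤ j} ∩
        {ω | ∀ u ∈ B, ω ∉ openConnIn {o}ᶜ v u}) +
      (prodBernoulli w).real ({ω : BondConfig V | (A.filter fun x => ω ∈ openConnIn {o}ᶜ v x).card ≤ j} ∩
        {ω | ∃ u ∈ B, ω ∈ openConnIn {o}ᶜ v u}) ≤
      (prodBernoulli w).real {ω : BondConfig V | (A.filter fun x => ω ∈ openConnIn {o}ᶜ c x).card ≤ j} := by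
  -- the graph `G ∖ {o}` and the monotone property "more than `j` relays"
  haveI : Fintype ({o}ᶜ : Set V) := Fintype.ofFinite _
  set f : ({o}ᶜ : Set V) → V := Subtype.val with hf
  set w' : Sym2 ({o}ᶜ : Set V) → unitInterval := w ∘ Sym2.map f with hw'
  set P : Set ({o}ᶜ : Set V) → Prop := fun T =>
    j < (A.filter fun x => ∃ hx : x ∈ ({o}ᶜ : Set V), (⟨x, hx⟩ : ({o}ᶜ : Set V)) ∈ T).card with hP
  have hPmono : ∀ T T' : Set ({o}ᶜ : Set V), T ⊆ T' → P T → P T' := by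
    intro T T' hTT' hT
    refine lt_of_lt_of_le hT (Finset.card_le_card (Finset.monotone_filter_right A fun x _ => ?_))
    rintro ⟨hx, h⟩
    exact ⟨hx, hTT' h⟩
  set c' : ({o}ᶜ : Set V) := ⟨c, mem_compl_singleton_iff.2 hc⟩ with hc'
  set v' : ({o}ᶜ : Set V) := ⟨v, mem_compl_singleton_iff.2 hv⟩ with hv'
  set B' : Set ({o}ᶜ : Set V) := {u : ({o}ᶜ : Set V) | (u : V) ∈ B} with hB'
  -- dictionary: `H`-events of `G` = pull-backs of events of `G ∖ {o}`
  have dsmall : ∀ {x : V} (hx : x ≠ o),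
      (prodBernoulli w).real {ω : BondConfig V | (A.filter fun y => ω ∈ openConnIn {o}ᶜ x y).card ≤ j} =
        (prodBernoulli w').real {ω' | ¬ P (openCluster ω' ⟨x, mem_compl_singleton_iff.2 hx⟩)} := by
    intro x hx
    rw [small_eq_preimage A j hx, hw', hf, real_preimage_restrictConfig_val]
    congr 1
    ext ω'
    simp only [mem_setOf_eq, hP, not_lt]
  have key := starRow_small w' P hPmono c' v' B'
    (by rw [← dsmall hv, ← dsmall hc]; exact hcv)
    (by
      obtain ⟨b, hbB, hb⟩ := hcB
      have hbo : b ≠ o := hB b hbB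
      refine ⟨⟨b, mem_compl_singleton_iff.2 hbo⟩, hbB, ?_⟩
      rw [← dsmall hbo, ← dsmall hc]; exact hb)
  -- read the conclusion back on `G`
  have e1 : (prodBernoulli w).real ({ω : BondConfig V |
        (A.filter fun x => ∃ u ∈ B, ω ∈ openConnIn {o}ᶜ u x).card ≤ j} ∩
        {ω | ∀ u ∈ B, ω ∉ openConnIn {o}ᶜ v u}) =
      (prodBernoulli w').real ({ω' | ¬ P (⋃ u ∈ B', openCluster ω' u)} ∩
        {ω' | ∀ u ∈ B', ¬ (openGraph ω').Reachable v' u}) := by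
    rw [usmall_eq_preimage A j hB, notConn_eq_preimage hB hv, ← preimage_inter, hw', hf,
      real_preimage_restrictConfig_val]
    congr 1
    ext ω'
    simp only [mem_inter_iff, mem_setOf_eq, hP, not_lt, hB']
    exact Iff.rfl
  have e2 : (prodBernoulli w).real ({ω : BondConfig V |
        (A.filter fun x => ω ∈ openConnIn {o}ᶜ v x).card ≤ j} ∩ {ω | ∃ u ∈ B, ω ∈ openConnIn {o}ᶜ v u}) =
      (prodBernoulli w').real ({ω' | ¬ P (openCluster ω' v')} ∩
        {ω' | ∃ u ∈ B', (openGraph ω').Reachable v' u}) := by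
    rw [small_eq_preimage A j hv, conn_eq_preimage hB hv, ← preimage_inter, hw', hf,
      real_preimage_restrictConfig_val]
    congr 1
    ext ω'
    simp only [mem_inter_iff, mem_setOf_eq, hP, not_lt, hB']
    exact Iff.rfl
  rw [e1, e2, dsmall hc]
  exact key

/-! ### The floor weights of a one-layer observer -/

omit [Fintype V] in
/-- `{x ∈ A : {a} ↔ x off o} = {x ∈ A : a ↔ x off o}`. [folklore] -/
theorem filter_union_singleton (A : Finset V) (o a : V) (ω : BondConfig V) :
    (A.filter fun x => ∃ u ∈ ({a} : Finset V), ω ∈ openConnIn {o}ᶜ u x) =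
      A.filter fun x => ω ∈ openConnIn {o}ᶜ a x :=
  Finset.filter_congr fun x _ => by simp

/-- **`{o ↔ a, N_a = 1}` lives on the star `{a}`**: for a one-layer observer and `a ∈ A`,
`μ(o ↔ a, N_a = 1) ≤ μ(σ_{{a}})·μ_H(a is `H`-lonely)` (`H`-lonely: at most one relay joined to `a` off `o`).  Under
`σ_B` with `B ≠ {a}`, `o ↔ a` forces a second relay into the cluster of `a`. [this work] -/
theorem real_conn_lonely_le (w : Sym2 V → unitInterval) (A : Finset V) {o : V} (ho : o ∉ A)
    (hiso : ∀ u, u ≠ o → u ∉ A → w s(o, u) = 0) {a : V} (haA : a ∈ A) :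
    (prodBernoulli w).real ((openConn o a : Set (BondConfig V)) ∩
        {ω | (A.filter fun x => ω ∈ openConn a x).card = 1}) ≤
      (prodBernoulli w).real (starEvent o (↑({a} : Finset V) : Set V)) *
        (prodBernoulli w).real {ω : BondConfig V | (A.filter fun x => ω ∈ openConnIn {o}ᶜ a x).card ≤ 1} := by
  set μ := prodBernoulli w with hμ
  have hao : a ≠ o := fun h => ho (h ▸ haA)
  set E : Set (BondConfig V) := (openConn o a : Set (BondConfig V)) ∩
    {ω | (A.filter fun x => ω ∈ openConn a x).card = 1} with hE
  set E1 : Set (BondConfig V) := {ω | (A.filter fun x => ω ∈ openConnIn {o}ᶜ a x).card ≤ 1} with hE1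
  rw [real_eq_sum_inter_starEvent w A o ho hiso E]
  have hterm : ∀ B ∈ A.powerset, μ.real (E ∩ starEvent o (↑B : Set V)) ≤
      if B = {a} then μ.real (starEvent o (↑({a} : Finset V) : Set V)) * μ.real E1 else 0 := by
    intro B hB
    have hBA : B ⊆ A := Finset.mem_powerset.1 hB
    have hB' : ∀ u ∈ B, u ≠ o := fun u hu h => ho (h ▸ hBA hu)
    split_ifs with hBa
    · subst hBa
      have hsub : E ∩ starEvent o (↑({a} : Finset V) : Set V) ⊆ E1 ∩ starEvent o (↑({a} : Finset V) : Set V) := by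
        rintro ω ⟨⟨-, hN⟩, hσ⟩
        refine ⟨?_, hσ⟩
        rw [mem_setOf_eq, filter_reachable_eq_union A ho hB' hσ hao
          ⟨a, Finset.mem_singleton_self a, openConnIn_rfl (mem_compl_singleton_iff.2 hao) ω⟩,
          filter_union_singleton] at hN
        rw [hE1, mem_setOf_eq, hN]
      refine (measureReal_mono hsub).trans (le_of_eq ?_)
      exact real_inter_starEvent_of_eq_preimage w o _ (small_eq_preimage A 1 hao)
    · have hempty : E ∩ starEvent o (↑B : Set V) = ∅ := by
        ext ω
        simp only [mem_inter_iff, mem_empty_iff_false, iff_false, not_and, hE, mem_setOf_eq]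
        rintro ⟨hoa, hN⟩ hσ
        obtain ⟨u', hu'B, hu'a⟩ := (reachable_obs_iff_of_starEvent hσ hB' hao).1 hoa
        have hau' : ω ∈ openConnIn {o}ᶜ a u' := by
          obtain ⟨h1, h2, hr⟩ := hu'a
          exact ⟨h2, h1, hr.symm⟩
        rw [filter_reachable_eq_union A ho hB' hσ hao ⟨u', hu'B, hau'⟩] at hN
        have haU : a ∈ A.filter fun x => ∃ u ∈ B, ω ∈ openConnIn {o}ᶜ u x :=
          Finset.mem_filter.2 ⟨haA, u', hu'B, hu'a⟩
        -- a second relay in `U(B)`: `u'` if `u' ≠ a`, else some `b ∈ B ∖ {a}`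
        have hsecond : ∃ b ∈ B, b ≠ a := by
          by_contra hcon
          push Not at hcon
          by_cases hu'a' : u' = a
          · exact hBa (Finset.eq_singleton_iff_unique_mem.2 ⟨hu'a' ▸ hu'B, hcon⟩)
          · exact hu'a' (hcon u' hu'B)
        obtain ⟨b, hbB, hba⟩ := hsecond
        have hbU := mem_filter_union_of_mem A hB' ω hbB (hBA hbB)
        have h2 : 1 < (A.filter fun x => ∃ u ∈ B, ω ∈ openConnIn {o}ᶜ u x).card :=
          Finset.one_lt_card.2 ⟨b, hbU, a, haU, hba⟩
        omega
      rw [hempty, measureReal_empty]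
  refine (Finset.sum_le_sum hterm).trans (le_of_eq ?_)
  rw [Finset.sum_ite_eq', if_pos (Finset.mem_powerset.2 (Finset.singleton_subset_iff.2 haA))]

/-- **`{N_a = 1}` contains the `H`-lonely configurations of the stars `{a}` and `B ∌ a`**: for a one-layer observer
and `a ∈ A`, `(μ(σ_{{a}}) + Σ_{B ⊆ A, a ∉ B} μ(σ_B))·μ_H(a is H-lonely) ≤ μ(N_a = 1)`. [this work] -/
theorem real_lonely_ge (w : Sym2 V → unitInterval) (A : Finset V) {o : V} (ho : o ∉ A)
    (hiso : ∀ u, u ≠ o → u ∉ A → w s(o, u) = 0) {a : V} (haA : a ∈ A) :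
    ((prodBernoulli w).real (starEvent o (↑({a} : Finset V) : Set V)) +
        ∑ B ∈ A.powerset.filter (fun B => a ∉ B), (prodBernoulli w).real (starEvent o (↑B : Set V))) *
      (prodBernoulli w).real {ω : BondConfig V | (A.filter fun x => ω ∈ openConnIn {o}ᶜ a x).card ≤ 1} ≤
      (prodBernoulli w).real {ω : BondConfig V | (A.filter fun x => ω ∈ openConn a x).card = 1} := by
  set μ := prodBernoulli w with hμ
  have hao : a ≠ o := fun h => ho (h ▸ haA)
  set N1 : Set (BondConfig V) := {ω | (A.filter fun x => ω ∈ openConn a x).card = 1} with hN1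
  set E1 : Set (BondConfig V) := {ω | (A.filter fun x => ω ∈ openConnIn {o}ᶜ a x).card ≤ 1} with hE1
  have haCl : ∀ ω : BondConfig V, a ∈ A.filter fun x => ω ∈ openConnIn {o}ᶜ a x := fun ω =>
    Finset.mem_filter.2 ⟨haA, openConnIn_rfl (mem_compl_singleton_iff.2 hao) ω⟩
  rw [real_eq_sum_inter_starEvent w A o ho hiso N1]
  have hterm : ∀ B ∈ A.powerset,
      (if B = {a} then μ.real (starEvent o (↑({a} : Finset V) : Set V)) * μ.real E1 else 0) +
        (if a ∉ B then μ.real (starEvent o (↑B : Set V)) * μ.real E1 else 0) ≤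
      μ.real (N1 ∩ starEvent o (↑B : Set V)) := by
    intro B hB
    have hBA : B ⊆ A := Finset.mem_powerset.1 hB
    have hB' : ∀ u ∈ B, u ≠ o := fun u hu h => ho (h ▸ hBA hu)
    by_cases hBa : B = {a}
    · subst hBa
      rw [if_pos rfl, if_neg (by simp), add_zero,
        ← real_inter_starEvent_of_eq_preimage w o _ (small_eq_preimage A 1 hao)]
      refine measureReal_mono ?_
      rintro ω ⟨h1, hσ⟩
      refine ⟨?_, hσ⟩
      rw [hN1, mem_setOf_eq, filter_reachable_eq_union A ho hB' hσ hao
        ⟨a, Finset.mem_singleton_self a, openConnIn_rfl (mem_compl_singleton_iff.2 hao) ω⟩,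
        filter_union_singleton]
      exact le_antisymm h1 (Finset.card_pos.2 ⟨a, haCl ω⟩)
    · rw [if_neg hBa, zero_add]
      by_cases haB : a ∉ B
      · rw [if_pos haB, ← real_inter_starEvent_of_eq_preimage w o _ (small_eq_preimage A 1 hao)]
        refine measureReal_mono ?_
        rintro ω ⟨h1, hσ⟩
        refine ⟨?_, hσ⟩
        have hcut : ∀ u ∈ B, ω ∉ openConnIn {o}ᶜ a u := by
          intro u huB hau
          have huCl : u ∈ A.filter fun x => ω ∈ openConnIn {o}ᶜ a x := Finset.mem_filter.2 ⟨hBA huB, hau⟩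
          have hne : u ≠ a := fun h => haB (h ▸ huB)
          have h2 := Finset.one_lt_card.2 ⟨u, huCl, a, haCl ω, hne⟩
          have h1' : (A.filter fun x => ω ∈ openConnIn {o}ᶜ a x).card ≤ 1 := h1
          omega
        rw [hN1, mem_setOf_eq, filter_reachable_eq_cluster A ho hB' hσ hao hcut]
        exact le_antisymm h1 (Finset.card_pos.2 ⟨a, haCl ω⟩)
      · rw [if_neg haB]
        exact measureReal_nonneg
  refine le_trans (le_of_eq ?_) (Finset.sum_le_sum hterm)
  rw [Finset.sum_add_distrib, Finset.sum_ite_eq',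
    if_pos (Finset.mem_powerset.2 (Finset.singleton_subset_iff.2 haA)), ← Finset.sum_filter,
    ← Finset.sum_mul]
  ring

/-- **The floor weight of a one-layer observer is at most its star value** (identity (L1) of the memo, as an
inequality covering the degenerate case `μ_H(a H-lonely) = 0` of Lean's `x/0 = 0`):
`μ(o ↔ a, N_a = 1)/μ(N_a = 1) ≤ μ(σ_{{a}})/(μ(σ_{{a}}) + Σ_{B ⊆ A, a ∉ B} μ(σ_B))`. [this work] -/
theorem phi_le (w : Sym2 V → unitInterval) (A : Finset V) {o : V} (ho : o ∉ A)
    (hiso : ∀ u, u ≠ o → u ∉ A → w s(o, u) = 0) {a : V} (haA : a ∈ A) :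
    (prodBernoulli w).real ((openConn o a : Set (BondConfig V)) ∩
          {ω | (A.filter fun x => ω ∈ openConn a x).card = 1}) /
        (prodBernoulli w).real {ω : BondConfig V | (A.filter fun x => ω ∈ openConn a x).card = 1} ≤
      (prodBernoulli w).real (starEvent o (↑({a} : Finset V) : Set V)) /
        ((prodBernoulli w).real (starEvent o (↑({a} : Finset V) : Set V)) +
          ∑ B ∈ A.powerset.filter (fun B => a ∉ B), (prodBernoulli w).real (starEvent o (↑B : Set V))) := by
  set μ := prodBernoulli w with hμ
  set num := μ.real ((openConn o a : Set (BondConfig V)) ∩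
    {ω | (A.filter fun x => ω ∈ openConn a x).card = 1}) with hnum
  set D := μ.real {ω : BondConfig V | (A.filter fun x => ω ∈ openConn a x).card = 1} with hD
  set s := μ.real (starEvent o (↑({a} : Finset V) : Set V)) with hs
  set X := ∑ B ∈ A.powerset.filter (fun B => a ∉ B), μ.real (starEvent o (↑B : Set V)) with hX
  set β := μ.real {ω : BondConfig V | (A.filter fun x => ω ∈ openConnIn {o}ᶜ a x).card ≤ 1} with hβ
  have hnum_le : num ≤ s * β := real_conn_lonely_le w A ho hiso haA
  have hden_ge : (s + X) * β ≤ D := real_lonely_ge w A ho hiso haA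
  have hnum0 : 0 ≤ num := measureReal_nonneg
  have hs0 : 0 ≤ s := measureReal_nonneg
  have hX0 : 0 ≤ X := Finset.sum_nonneg fun B _ => measureReal_nonneg
  have hβ0 : 0 ≤ β := measureReal_nonneg
  have hRHS0 : 0 ≤ s / (s + X) := div_nonneg hs0 (add_nonneg hs0 hX0)
  by_cases hnum0' : num = 0
  · rw [hnum0', zero_div]; exact hRHS0
  have hnumpos : 0 < num := lt_of_le_of_ne hnum0 (Ne.symm hnum0')
  have hsβ : 0 < s * β := lt_of_lt_of_le hnumpos hnum_le
  have hspos : 0 < s := lt_of_le_of_ne hs0 (fun h => by rw [← h, zero_mul] at hsβ; exact lt_irrefl _ hsβ)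
  have hβpos : 0 < β := lt_of_le_of_ne hβ0 (fun h => by rw [← h, mul_zero] at hsβ; exact lt_irrefl _ hsβ)
  have hdenpos : 0 < (s + X) * β := mul_pos (by linarith) hβpos
  calc num / D ≤ num / ((s + X) * β) := div_le_div_of_nonneg_left hnum0 hdenpos hden_ge
    _ ≤ s * β / ((s + X) * β) := div_le_div_of_nonneg_right hnum_le hdenpos.le
    _ = s / (s + X) := mul_div_mul_right _ _ (ne_of_gt hβpos)

end FloorSplitOneLayer

end Summit.CriticalPhenomena.PercolationContinuityZ3.Theorems

end
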